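import Literature.Computability.QuantumComplexity.ForrelationThm25Sign
import Literature.Computability.QuantumComplexity.CircuitEmbedding
import HarnessLib

/-!
# Aaronson–Ambainis Lemma 24 over the sign basis, III: the magic-state gadget, certified exactly

Third file of the discharge of `AaronsonAmbainis2018_lemma24_sign_hard` (plan in
`Lemma24Catalysis.lean`). The only inexact ingredient of the reduction is the preparation of the
realification of the magic state `|A⟩ = (|0⟩ + ω|1⟩)/√2` on the catalyst wire `a` and the
real/imaginary wire `ρ`, i.e. of the real vector `(1/√2)|a=0,ρ=0⟩ + ½|1,0⟩ + ½|1,1⟩`, which is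
of mixed dyadic type and hence not reachable by any sign-basis circuit from `|0…0⟩`
(`Lemma24Catalysis.lean`, module docstring). This file fixes ONE explicit sign-basis circuit `gadget`
on three wires `(a, ρ, h)` (`h` a helper wire, 25 gates, 16 of them Hadamard; found by exhaustive
search) and certifies its output state EXACTLY:

  `gadget |000⟩ = (3|000⟩ − 3|001⟩ − 3|010⟩ + 2|011⟩ + 4|100⟩ − 4|101⟩ − |111⟩)/8`

(`gadget_mulVec_zero`; labels `|a ρ h⟩`). Read as a complex state of the two qubits `(a, h)`
(real part on `ρ = 0`, imaginary part on `ρ = 1`, file II) its weight on the `|A⊥⟩`-branch of the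
catalyst is `1/2 − 45√2/128 ≈ 0.0028` (sequel), which is what the thresholds of the reduction absorb.

The certificate is an exact state-vector simulation in `ℤ[√2]/2^k` (entries `(p + q√2)/2^k`, one
more `k` per Hadamard gate, no normalisation): `GSt` with its semantics `GSt.sem`, one step function
per gate (`GOp.step`), the bridge `toMatrix_mulVec_sem` (each gate acts on the semantics as its step
acts on the data; Nielsen–Chuang 2010, §4.2: `H`, and the `±1` diagonal gates), the run lemma
`toMatrix_run_mulVec_sem`, and the evaluation of the 25 steps by `decide`.

## References

* S. Aaronson, A. Ambainis, *Forrelation*, SIAM J. Comput. 47 (2018), §6, Lemma 24 (p. 26).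
* M. A. Nielsen, I. L. Chuang, *Quantum Computation and Quantum Information*, CUP 2010, §4.2
  (action of `H` and of diagonal phase gates on amplitudes), §10.6.2 (the magic state of `T`).
* M. Amy, A. N. Glaudell, N. J. Ross, Quantum 4 (2020) 252 (sign-basis amplitudes lie in `ℤ[√2]/2^k`).
-/

noncomputable section

namespace Literature.Computability.QuantumComplexity

open Matrix _root_.Computability Complexity Cryptography Finset

namespace Lemma24

/-! ### Exact amplitudes `(p + q√2)/2^k` -/

/-- The value `p + q√2 ∈ ℂ` of an integer pair. [cite: NielsenChuang2010, §4.2] -/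
def zval (u : ℤ × ℤ) : ℂ := (u.1 : ℂ) + (u.2 : ℂ) * (Real.sqrt 2 : ℂ)

/-- The Hadamard sum `(u + v)/√2` in the scaled representation: `(p + q√2)/√2 · 2 = 2q + p√2`.
[cite: NielsenChuang2010, §4.2] -/
def hplus (u v : ℤ × ℤ) : ℤ × ℤ := (2 * (u.2 + v.2), u.1 + v.1)

/-- The Hadamard difference `(u − v)/√2` in the scaled representation. [cite: NielsenChuang2010, §4.2] -/
def hminus (u v : ℤ × ℤ) : ℤ × ℤ := (2 * (u.2 - v.2), u.1 - v.1)

/-- `zval` of a negated pair. [folklore] -/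
theorem zval_neg (u : ℤ × ℤ) : zval (-u) = -zval u := by
  simp only [zval, Prod.fst_neg, Prod.snd_neg, Int.cast_neg]; ring

/-- `√2 · √2 = 2` in `ℂ`. [folklore] -/
theorem sqrt2_mul_sqrt2 : ((Real.sqrt 2 : ℝ) : ℂ) * (Real.sqrt 2 : ℂ) = 2 := by
  rw [← Complex.ofReal_mul, Real.mul_self_sqrt (by norm_num : (0:ℝ) ≤ 2)]; norm_num

/-- `√2 ≠ 0` in `ℂ`. [folklore] -/
theorem sqrt2_ne_zero : ((Real.sqrt 2 : ℝ) : ℂ) ≠ 0 := by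
  rw [Ne, Complex.ofReal_eq_zero]; exact Real.sqrt_ne_zero'.2 (by norm_num)

/-- `zval (hplus u v) = √2 · (zval u + zval v)`. [cite: NielsenChuang2010, §4.2] -/
theorem zval_hplus (u v : ℤ × ℤ) : zval (hplus u v) = (Real.sqrt 2 : ℂ) * (zval u + zval v) := by
  simp only [zval, hplus, Int.cast_mul, Int.cast_add, Int.cast_ofNat]
  linear_combination (-(u.2 : ℂ) - v.2) * sqrt2_mul_sqrt2

/-- `zval (hminus u v) = √2 · (zval u − zval v)`. [cite: NielsenChuang2010, §4.2] -/
theorem zval_hminus (u v : ℤ × ℤ) : zval (hminus u v) = (Real.sqrt 2 : ℂ) * (zval u - zval v) := by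
  simp only [zval, hminus, Int.cast_mul, Int.cast_sub, Int.cast_ofNat]
  linear_combination (-(u.2 : ℂ) + v.2) * sqrt2_mul_sqrt2

/-- `1/√2 = √2/2`. [folklore] -/
theorem inv_sqrt2_eq : ((Real.sqrt 2 : ℝ) : ℂ)⁻¹ = (Real.sqrt 2 : ℂ) / 2 := by
  rw [eq_div_iff (two_ne_zero' ℂ), ← sqrt2_mul_sqrt2, inv_mul_cancel_left₀ sqrt2_ne_zero]

/-- **The scaled Hadamard sum is correct**: `(1/√2)(zval u/2^k + zval v/2^k) = zval (hplus u v)/2^{k+1}`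
(stated in `simp`-normal form). [cite: NielsenChuang2010, §4.2] -/
theorem hplus_sem (u v : ℤ × ℤ) (k : ℕ) :
    ((Real.sqrt 2 : ℝ) : ℂ)⁻¹ * (zval u / 2 ^ k) + ((Real.sqrt 2 : ℝ) : ℂ)⁻¹ * (zval v / 2 ^ k) =
      zval (hplus u v) / 2 ^ (k + 1) := by
  rw [zval_hplus, inv_sqrt2_eq, pow_succ]
  field_simp

/-- **The scaled Hadamard difference is correct** (in `simp`-normal form). [cite: NielsenChuang2010, §4.2] -/
theorem hminus_sem (u v : ℤ × ℤ) (k : ℕ) :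
    ((Real.sqrt 2 : ℝ) : ℂ)⁻¹ * (zval u / 2 ^ k) + -(((Real.sqrt 2 : ℝ) : ℂ)⁻¹ * (zval v / 2 ^ k)) =
      zval (hminus u v) / 2 ^ (k + 1) := by
  rw [zval_hminus, inv_sqrt2_eq, pow_succ]
  field_simp
  ring

/-! ### Exact three-wire states -/

/-- An exact three-wire state: eight integer pairs (entry `e(4a+2b+c)` is the amplitude of `|a b c⟩`)
and the scale exponent `k`; semantics `(p + q√2)/2^k`. [cite: NielsenChuang2010, §4.2] -/
structure GSt where
  /-- Amplitude data of `|000⟩`. -/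
  e0 : ℤ × ℤ
  /-- Amplitude data of `|001⟩`. -/
  e1 : ℤ × ℤ
  /-- Amplitude data of `|010⟩`. -/
  e2 : ℤ × ℤ
  /-- Amplitude data of `|011⟩`. -/
  e3 : ℤ × ℤ
  /-- Amplitude data of `|100⟩`. -/
  e4 : ℤ × ℤ
  /-- Amplitude data of `|101⟩`. -/
  e5 : ℤ × ℤ
  /-- Amplitude data of `|110⟩`. -/
  e6 : ℤ × ℤ
  /-- Amplitude data of `|111⟩`. -/
  e7 : ℤ × ℤ
  /-- Scale exponent: every amplitude is divided by `2^k`. -/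
  k : ℕ
  deriving DecidableEq

namespace GSt

/-- The entry of the label `|a b c⟩`. [folklore] -/
def entry (s : GSt) : Bool → Bool → Bool → ℤ × ℤ
  | false, false, false => s.e0
  | false, false, true => s.e1
  | false, true, false => s.e2
  | false, true, true => s.e3
  | true, false, false => s.e4
  | true, false, true => s.e5
  | true, true, false => s.e6
  | true, true, true => s.e7

/-- **Semantics**: the state vector `|a b c⟩ ↦ zval (entry a b c) / 2^k`. [cite: NielsenChuang2010, §4.2] -/
def sem (s : GSt) : QReg 3 → ℂ := fun x => zval (s.entry (x 0) (x 1) (x 2)) / 2 ^ s.k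

/-- Hadamard on wire `0` (pairs `e_j, e_{j+4}`). [cite: NielsenChuang2010, §4.2] -/
def stepH0 (s : GSt) : GSt :=
  ⟨hplus s.e0 s.e4, hplus s.e1 s.e5, hplus s.e2 s.e6, hplus s.e3 s.e7,
   hminus s.e0 s.e4, hminus s.e1 s.e5, hminus s.e2 s.e6, hminus s.e3 s.e7, s.k + 1⟩

/-- Hadamard on wire `1` (pairs `e_j, e_{j+2}`). [cite: NielsenChuang2010, §4.2] -/
def stepH1 (s : GSt) : GSt :=
  ⟨hplus s.e0 s.e2, hplus s.e1 s.e3, hminus s.e0 s.e2, hminus s.e1 s.e3,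
   hplus s.e4 s.e6, hplus s.e5 s.e7, hminus s.e4 s.e6, hminus s.e5 s.e7, s.k + 1⟩

/-- Hadamard on wire `2` (pairs `e_j, e_{j+1}`). [cite: NielsenChuang2010, §4.2] -/
def stepH2 (s : GSt) : GSt :=
  ⟨hplus s.e0 s.e1, hminus s.e0 s.e1, hplus s.e2 s.e3, hminus s.e2 s.e3,
   hplus s.e4 s.e5, hminus s.e4 s.e5, hplus s.e6 s.e7, hminus s.e6 s.e7, s.k + 1⟩

/-- `Z` on wire `0`: negate the amplitudes with `a = 1`. [cite: NielsenChuang2010, §4.2] -/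
def stepZ0 (s : GSt) : GSt := ⟨s.e0, s.e1, s.e2, s.e3, -s.e4, -s.e5, -s.e6, -s.e7, s.k⟩

/-- `CZ` on wires `0, 1`: negate the amplitudes with `a = b = 1`. [cite: NielsenChuang2010, §4.3] -/
def stepCZ01 (s : GSt) : GSt := ⟨s.e0, s.e1, s.e2, s.e3, s.e4, s.e5, -s.e6, -s.e7, s.k⟩

/-- `CZ` on wires `0, 2`: negate the amplitudes with `a = c = 1`. [cite: NielsenChuang2010, §4.3] -/
def stepCZ02 (s : GSt) : GSt := ⟨s.e0, s.e1, s.e2, s.e3, s.e4, -s.e5, s.e6, -s.e7, s.k⟩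

/-- `CCZ`: negate the amplitude of `|111⟩`. [cite: NielsenChuang2010, §4.3] -/
def stepCCZ (s : GSt) : GSt := ⟨s.e0, s.e1, s.e2, s.e3, s.e4, s.e5, s.e6, -s.e7, s.k⟩

/-- The initial state `|000⟩`. [folklore] -/
def init : GSt := ⟨(1, 0), (0, 0), (0, 0), (0, 0), (0, 0), (0, 0), (0, 0), (0, 0), 0⟩

end GSt

/-! ### The gates of the gadget and their action on exact states -/

/-- The seven gate kinds used by the gadget (three wires `0 = a`, `1 = ρ`, `2 = h`). [folklore] -/
inductive GOp
  | H0 | H1 | H2 | Z0 | CZ01 | CZ02 | CCZ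
  deriving DecidableEq

namespace GOp

/-- `(0 : Fin 3) ≠ 1`. [folklore] -/
theorem zero_ne_one3 : (0 : Fin 3) ≠ 1 := by decide
/-- `(0 : Fin 3) ≠ 2`. [folklore] -/
theorem zero_ne_two3 : (0 : Fin 3) ≠ 2 := by decide

/-- The sign-basis gate of a gate kind. [cite: AaronsonAmbainis2018, §6 (the basis {H, Z, CZ, CCZ})] -/
def toGate : GOp → QGate hSign 3
  | H0 => QGate.gate HSignOp.H (wireEmb 0)
  | H1 => QGate.gate HSignOp.H (wireEmb 1)
  | H2 => QGate.gate HSignOp.H (wireEmb 2)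
  | Z0 => QGate.gate HSignOp.Z (wireEmb 0)
  | CZ01 => QGate.gate HSignOp.CZ (pairEmb 0 1 zero_ne_one3)
  | CZ02 => QGate.gate HSignOp.CZ (pairEmb 0 2 zero_ne_two3)
  | CCZ => QGate.gate HSignOp.CCZ (Function.Embedding.refl (Fin 3))

/-- The exact step of a gate kind. [cite: NielsenChuang2010, §4.2] -/
def step : GOp → GSt → GSt
  | H0 => GSt.stepH0
  | H1 => GSt.stepH1
  | H2 => GSt.stepH2
  | Z0 => GSt.stepZ0
  | CZ01 => GSt.stepCZ01
  | CZ02 => GSt.stepCZ02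
  | CCZ => GSt.stepCCZ

/-- Every gate of the gadget is oracle-free. [folklore] -/
theorem toGate_isOracleFree (o : GOp) : (toGate o).IsOracleFree := by
  cases o <;> exact trivial

end GOp

/-- Every three-wire label is the vector of its three bits. [folklore] -/
theorem eq_vec3 (x : QReg 3) : x = ![x 0, x 1, x 2] := by
  funext i; fin_cases i <;> rfl

/-- A statement about all three-wire labels is a statement about all bit triples. [folklore] -/
theorem forall_qReg_three {P : QReg 3 → Prop} (h : ∀ a b c : Bool, P ![a, b, c]) (x : QReg 3) : P x := by
  rw [eq_vec3 x]; exact h _ _ _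

/-- **A placed Hadamard gate, entrywise**: `(H_i ψ)(x) = (ψ(x[i↦0]) + (−1)^{x_i} ψ(x[i↦1]))/√2`.
[cite: NielsenChuang2010, §4.2] -/
theorem placeGate_hGate_mulVec_apply {N : ℕ} (i : Fin N) (ψ : QReg N → ℂ) (x : QReg N) :
    (placeGate (wireEmb i) hGate *ᵥ ψ) x =
      invSqrt2 * ψ (Function.update x i false) +
        (if x i then -invSqrt2 else invSqrt2) * ψ (Function.update x i true) := by
  rw [placeGate_mulVec_apply, sum_qReg_one, Fintype.sum_bool, extend_fin_one, extend_fin_one, add_comm]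
  have hx : x ∘ wireEmb i = fun _ => x i := funext fun _ => by simp
  rw [hx]
  cases x i <;> simp [hGate, invSqrt2]

/-- **A placed diagonal gate, entrywise**: `(D_E ψ)(x) = D(x|_E, x|_E) ψ(x)`. [cite: NielsenChuang2010, §4.2] -/
theorem placeGate_mulVec_apply_of_diag {N b : ℕ} (E : Fin b ↪ Fin N) {D : Matrix (QReg b) (QReg b) ℂ}
    (hD : ∀ z z', z ≠ z' → D z z' = 0) (ψ : QReg N → ℂ) (x : QReg N) :
    (placeGate E D *ᵥ ψ) x = D (x ∘ E) (x ∘ E) * ψ x := by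
  rw [placeGate_mulVec_apply, Finset.sum_eq_single (x ∘ E)]
  · have hx : Function.extend E (x ∘ E) x = x := by
      funext j
      by_cases hj : ∃ l, E l = j
      · obtain ⟨l, rfl⟩ := hj
        rw [E.injective.extend_apply]; rfl
      · rw [Function.extend_apply' _ _ _ hj]
    rw [hx]
  · intro z _ hz
    rw [hD _ _ (Ne.symm hz), zero_mul]
  · intro h; exact absurd (Finset.mem_univ _) h

/-- `Z` is diagonal. [folklore] -/
theorem pauliZ_off_diag (z z' : QReg 1) (h : z ≠ z') : pauliZ z z' = 0 := by simp [pauliZ, h]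
/-- `CZ` is diagonal. [folklore] -/
theorem cz_off_diag (z z' : QReg 2) (h : z ≠ z') : cz z z' = 0 := by simp [cz, h]
/-- `CCZ` is diagonal. [folklore] -/
theorem ccsign_off_diag (z z' : QReg 3) (h : z ≠ z') : ccsign z z' = 0 := by
  simp [ccsign, Matrix.diagonal_apply_ne _ h]

/-- **The bridge**: every gate of the gadget acts on the semantics of an exact state as its exact
step acts on the data. [cite: NielsenChuang2010, §4.2] -/
theorem toMatrix_mulVec_sem (o : GOp) (s : GSt) : (o.toGate).toMatrix 0 *ᵥ s.sem = (o.step s).sem := by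
  funext x
  induction x using forall_qReg_three with
  | h a b c =>
    cases o
    · -- H on wire 0
      change (placeGate (wireEmb 0) hGate *ᵥ s.sem) _ = _
      rw [placeGate_hGate_mulVec_apply]
      cases a <;> cases b <;> cases c <;>
        simp [GSt.sem, GSt.entry, GOp.step, GSt.stepH0, Function.update, Fin.ext_iff, hplus_sem, hminus_sem]
    · -- H on wire 1
      change (placeGate (wireEmb 1) hGate *ᵥ s.sem) _ = _
      rw [placeGate_hGate_mulVec_apply]
      cases a <;> cases b <;> cases c <;>
        simp [GSt.sem, GSt.entry, GOp.step, GSt.stepH1, Function.update, Fin.ext_iff, hplus_sem, hminus_sem]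
    · -- H on wire 2
      change (placeGate (wireEmb 2) hGate *ᵥ s.sem) _ = _
      rw [placeGate_hGate_mulVec_apply]
      cases a <;> cases b <;> cases c <;>
        simp [GSt.sem, GSt.entry, GOp.step, GSt.stepH2, Function.update, Fin.ext_iff, hplus_sem, hminus_sem]
    · -- Z on wire 0
      change (placeGate (wireEmb 0) pauliZ *ᵥ s.sem) _ = _
      rw [placeGate_mulVec_apply_of_diag _ pauliZ_off_diag]
      cases a <;> cases b <;> cases c <;>
        simp [GSt.sem, GSt.entry, GOp.step, GSt.stepZ0, pauliZ, zval_neg, neg_div]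
    · -- CZ on wires 0, 1
      change (placeGate (pairEmb 0 1 GOp.zero_ne_one3) cz *ᵥ s.sem) _ = _
      rw [placeGate_mulVec_apply_of_diag _ cz_off_diag]
      cases a <;> cases b <;> cases c <;>
        simp [GSt.sem, GSt.entry, GOp.step, GSt.stepCZ01, cz, zval_neg, neg_div]
    · -- CZ on wires 0, 2
      change (placeGate (pairEmb 0 2 GOp.zero_ne_two3) cz *ᵥ s.sem) _ = _
      rw [placeGate_mulVec_apply_of_diag _ cz_off_diag]
      cases a <;> cases b <;> cases c <;>
        simp [GSt.sem, GSt.entry, GOp.step, GSt.stepCZ02, cz, zval_neg, neg_div]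
    · -- CCZ
      change (placeGate (Function.Embedding.refl (Fin 3)) ccsign *ᵥ s.sem) _ = _
      rw [placeGate_mulVec_apply_of_diag _ ccsign_off_diag]
      cases a <;> cases b <;> cases c <;>
        simp [GSt.sem, GSt.entry, GOp.step, GSt.stepCCZ, ccsign, zval_neg, neg_div, Matrix.diagonal_apply_eq]

/-- **Running a gate list**: the circuit of a list of gate kinds acts on the semantics as the fold of
the exact steps acts on the data. [cite: NielsenChuang2010, §4.2] -/
theorem toMatrix_run_mulVec_sem (ops : List GOp) (s : GSt) :
    (⟨ops.map GOp.toGate⟩ : QCircuit hSign 3).toMatrix 0 *ᵥ s.sem = (ops.foldl (fun s o => o.step s) s).sem := by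
  induction ops generalizing s with
  | nil => simp
  | cons o ops ih =>
    rw [List.map_cons, QCircuit.toMatrix_cons, ← Matrix.mulVec_mulVec, toMatrix_mulVec_sem, List.foldl_cons, ih]

/-- The semantics of the initial data is `|000⟩`. [folklore] -/
theorem sem_init : GSt.init.sem = basisState (fun _ => false) := by
  funext x
  induction x using forall_qReg_three with
  | h a b c =>
    rw [basisState_apply]
    cases a <;> cases b <;> cases c <;> simp [GSt.sem, GSt.entry, GSt.init, zval, funext_iff, Fin.forall_fin_succ]

/-! ### The gadget -/

/-- **The gadget word** (25 gates on the wires `0 = a`, `1 = ρ`, `2 = h`), found by exhaustive search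
among sign-basis words for small weight on the `|A⊥⟩`-branch. [cite: AaronsonAmbainis2018, §6 Lemma 24 (p. 26)] -/
def gadgetOps : List GOp :=
  [.H0, .H1, .H2, .Z0, .CCZ, .H0, .H1, .H2, .CCZ, .H1, .H2, .CZ01, .H0, .CCZ, .H1, .H2, .CCZ, .H0, .CCZ, .H0, .H1, .H2, .CCZ, .H0, .CZ02]

/-- **The gadget circuit** over the sign basis. [cite: AaronsonAmbainis2018, §6 Lemma 24 (p. 26)] -/
def gadget : QCircuit hSign 3 := ⟨gadgetOps.map GOp.toGate⟩

/-- The gadget has `25` gates. [folklore] -/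
theorem size_gadget : gadget.size = 25 := rfl

/-- The gadget is oracle-free. [folklore] -/
theorem gadget_isOracleFree : gadget.IsOracleFree := by
  intro g hg
  obtain ⟨o, -, rfl⟩ := List.mem_map.1 hg
  exact GOp.toGate_isOracleFree o

/-- The exact final data of the gadget run: scale `2^16`, entries `8192 · (3, −3, −3, 2, 4, −4, 0, −1)`.
[cite: AaronsonAmbainis2018, §6 Lemma 24 (p. 26)] -/
def gadgetFinal : GSt :=
  ⟨(24576, 0), (-24576, 0), (-24576, 0), (16384, 0), (32768, 0), (-32768, 0), (0, 0), (-8192, 0), 16⟩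

/-- **The 25 exact steps, evaluated.** [folklore] -/
theorem run_gadgetOps : gadgetOps.foldl (fun s o => o.step s) GSt.init = gadgetFinal := by
  decide

/-- The integer table of the output state (times `8`), indexed by the bits `(a, ρ, h)`. [folklore] -/
def gadgetInt : Bool → Bool → Bool → ℤ
  | false, false, false => 3
  | false, false, true => -3
  | false, true, false => -3
  | false, true, true => 2
  | true, false, false => 4
  | true, false, true => -4
  | true, true, false => 0
  | true, true, true => -1

/-- **The output state of the gadget**: `|a ρ h⟩ ↦ gadgetInt a ρ h / 8`. [folklore] -/
def gadgetVec : QReg 3 → ℂ := fun x => (gadgetInt (x 0) (x 1) (x 2) : ℂ) / 8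

/-- The semantics of the final data is `gadgetVec`. [folklore] -/
theorem sem_gadgetFinal : gadgetFinal.sem = gadgetVec := by
  funext x
  induction x using forall_qReg_three with
  | h a b c =>
    cases a <;> cases b <;> cases c <;> simp [GSt.sem, GSt.entry, gadgetFinal, gadgetVec, gadgetInt, zval] <;> norm_num

/-- **The gadget prepares `gadgetVec` exactly**:
`gadget |000⟩ = (3|000⟩ − 3|001⟩ − 3|010⟩ + 2|011⟩ + 4|100⟩ − 4|101⟩ − |111⟩)/8`.
[cite: AaronsonAmbainis2018, §6 Lemma 24 (p. 26)] -/
theorem gadget_mulVec_zero : gadget.toMatrix 0 *ᵥ basisState (fun _ => false) = gadgetVec := by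
  rw [← sem_init, gadget, toMatrix_run_mulVec_sem, run_gadgetOps, sem_gadgetFinal]

/-- The squared norms of the output amplitudes sum to `1` (`9+9+9+4+16+16+0+1 = 64`). [folklore] -/
theorem sum_sq_gadgetInt : ∑ a : Bool, ∑ b : Bool, ∑ c : Bool, (gadgetInt a b c : ℚ) ^ 2 = 64 := by
  simp [gadgetInt]; norm_num

end Lemma24

end Literature.Computability.QuantumComplexity

end
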